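import Mathlib
import Literature.NumberTheory.Sieve.ParityWave0

/-!
# Route LiouvilleSarnak — crux `LiouvilleCutRank` (stmt-ValiantsHypothesis-14775):
# Chowla's conjecture gives every finite sign pattern of `λ` (route-independent tool)

`Theorems/LiouvilleSarnakLiouvilleCutRankSignPatterns.lean` proved `(SP) ⇒ LiouvilleCutRank`, where
`(SP)` = "every finite sign pattern occurs in the Liouville sequence".  This file derives `(SP)` from the
tree's NAMED conjecture `Literature.NumberTheory.Sieve.ChowlaConjecture` (parity.S06:
`Σ_{n<x} λ(n+h₁)⋯λ(n+h_k) = o(x)` for distinct shifts), so that the crux is placed below a registered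
conjecture: `signPatterns_of_chowla : ChowlaConjecture → (SP)`.

Proof (the standard inclusion–exclusion): for a pattern `ε ∈ {±1}^k` put
`P(n) = Π_{i<k} (1 + ε_i λ(n + i + 1)) ∈ {0, 2^k}`, equal to `2^k` iff the pattern occurs at `n`.
Expanding, `Σ_{n<x} P(n) = x + Σ_{∅ ≠ t ⊆ [k]} (Π_{i∈t} ε_i) Σ_{n<x} Π_{i∈t} λ(n + i + 1)`, and each
inner sum is a Chowla correlation with distinct shifts `{i + 1 : i ∈ t}`, hence `o(x)`.  If the pattern
never occurred, the left side would vanish identically and `x = o(x)` — absurd.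

Honest framing: a conditional tool (Chowla's conjecture is OPEN; it enters as the hypothesis of an
implication, by its tree name); nothing here bears on VP versus VNP.  No definitions.
-/

-- the directory `ValiantsHypothesis/ValiantsHypothesis` repeats the summit name (tree layout)
set_option linter.dupNamespace false

namespace Summit.ValiantsHypothesis.ValiantsHypothesis.Theorems.LiouvilleSarnakLiouvilleCutRank.SignPatterns

open ArithmeticFunction Finset Filter Asymptotics

open Literature.NumberTheory.Sieve (liouvilleCorrelation ChowlaConjecture)

/-- A correlation of `λ` over the shifts `{i + 1 : i ∈ t}` (`t ⊆ Fin k`) is the tree's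
`liouvilleCorrelation` for the enumeration of `t`. [folklore] -/
theorem sum_prod_liouville_eq_correlation {k : ℕ} (t : Finset (Fin k)) (x : ℕ)
    (e : {i // i ∈ t} ≃ Fin t.card) :
    (∑ n ∈ range x, ∏ i ∈ t, (liouville (n + i + 1) : ℤ)) =
      liouvilleCorrelation (fun j : Fin t.card => ((e.symm j : {i // i ∈ t}) : Fin k) + 1) x := by
  unfold liouvilleCorrelation
  refine Finset.sum_congr rfl fun n _ => ?_
  rw [← Finset.prod_coe_sort t]
  exact Fintype.prod_equiv e _ _ (fun a => by simp [Nat.add_assoc])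

/-- ★ **Chowla's conjecture ⇒ every finite sign pattern occurs in `λ`.**  For every `k` and
`p : Fin k → Bool` there is `m` with `λ(m + i + 1) = +1` if `p i` and `-1` otherwise, for all `i < k`
(inclusion–exclusion over `Π_i (1 + ε_i λ(n + i + 1))` and `x ≠ o(x)`). [folklore] -/
theorem signPatterns_of_chowla (hC : ChowlaConjecture) :
    ∀ k : ℕ, ∀ p : Fin k → Bool, ∃ m : ℕ, ∀ i : Fin k,
      liouville (m + i + 1) = if p i then 1 else -1 := by
  classical
  intro k p
  by_contra hno
  push Not at hno
  set ε : Fin k → ℤ := fun i => if p i then 1 else -1 with hε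
  -- the detector vanishes identically
  have hP : ∀ n : ℕ, ∏ i : Fin k, (1 + ε i * (liouville (n + i + 1) : ℤ)) = 0 := by
    intro n
    obtain ⟨i, hi⟩ := hno n
    apply Finset.prod_eq_zero (Finset.mem_univ i)
    have hl : (liouville (n + i + 1) : ℤ) = 1 ∨ (liouville (n + i + 1) : ℤ) = -1 := by
      rw [liouville_apply (by omega)]
      exact neg_one_pow_eq_or ℤ _
    by_cases hp : p i
    · rw [if_pos hp] at hi
      have h1 : (liouville (n + i + 1) : ℤ) = -1 := hl.resolve_left hi
      rw [hε]
      simp only [if_pos hp, h1]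
      norm_num
    · rw [if_neg hp] at hi
      have h1 : (liouville (n + i + 1) : ℤ) = 1 := hl.resolve_right hi
      rw [hε]
      simp only [if_neg hp, h1]
      norm_num
  -- expansion and summation over `n < x`
  have hsum : ∀ x : ℕ, (0 : ℤ) =
      ∑ t ∈ (Finset.univ : Finset (Fin k)).powerset,
        (∏ i ∈ t, ε i) * ∑ n ∈ range x, ∏ i ∈ t, (liouville (n + i + 1) : ℤ) := by
    intro x
    calc (0 : ℤ) = ∑ n ∈ range x, ∏ i : Fin k, (1 + ε i * (liouville (n + i + 1) : ℤ)) := by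
          rw [Finset.sum_eq_zero fun n _ => hP n]
      _ = ∑ n ∈ range x, ∑ t ∈ (Finset.univ : Finset (Fin k)).powerset,
            ∏ i ∈ t, (ε i * (liouville (n + i + 1) : ℤ)) :=
          Finset.sum_congr rfl fun n _ => Finset.prod_one_add _
      _ = ∑ t ∈ (Finset.univ : Finset (Fin k)).powerset, ∑ n ∈ range x,
            ∏ i ∈ t, (ε i * (liouville (n + i + 1) : ℤ)) := Finset.sum_comm
      _ = _ := by
          refine Finset.sum_congr rfl fun t _ => ?_
          rw [Finset.mul_sum]
          refine Finset.sum_congr rfl fun n _ => ?_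
          rw [Finset.prod_mul_distrib]
  -- isolate the empty set: its term is `x`
  have hx_eq : ∀ x : ℕ, (x : ℝ) =
      -∑ t ∈ ((Finset.univ : Finset (Fin k)).powerset).erase ∅,
        ((∏ i ∈ t, ε i : ℤ) : ℝ) * ((∑ n ∈ range x, ∏ i ∈ t, (liouville (n + i + 1) : ℤ) : ℤ) : ℝ) := by
    intro x
    have h := hsum x
    rw [← Finset.add_sum_erase _ _ (Finset.empty_mem_powerset _)] at h
    simp only [Finset.prod_empty, Finset.sum_const, Finset.card_range, nsmul_eq_mul, mul_one,
      one_mul] at h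
    have h' : (x : ℤ) = -∑ t ∈ ((Finset.univ : Finset (Fin k)).powerset).erase ∅,
        (∏ i ∈ t, ε i) * ∑ n ∈ range x, ∏ i ∈ t, (liouville (n + i + 1) : ℤ) := by
      linarith
    have h'' := congrArg (fun z : ℤ => (z : ℝ)) h'
    push_cast at h''
    rw [h'']
    push_cast
    rfl
  -- each nonempty correlation is `o(x)` by Chowla
  have hlo : ∀ t ∈ ((Finset.univ : Finset (Fin k)).powerset).erase ∅,
      (fun x : ℕ => ((∏ i ∈ t, ε i : ℤ) : ℝ) *
        ((∑ n ∈ range x, ∏ i ∈ t, (liouville (n + i + 1) : ℤ) : ℤ) : ℝ)) =o[atTop]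
      fun x : ℕ => (x : ℝ) := by
    intro t ht
    have htne : t.Nonempty := Finset.nonempty_iff_ne_empty.mpr (Finset.ne_of_mem_erase ht)
    have hcard : 0 < t.card := Finset.card_pos.mpr htne
    set e : {i // i ∈ t} ≃ Fin t.card := Fintype.equivFinOfCardEq (Fintype.card_coe t) with he
    have hinj : Function.Injective
        (fun j : Fin t.card => (((e.symm j : {i // i ∈ t}) : Fin k) : ℕ) + 1) := by
      intro a b hab
      have h1 : (((e.symm a : {i // i ∈ t}) : Fin k) : ℕ) = (((e.symm b : {i // i ∈ t}) : Fin k) : ℕ) :=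
        Nat.add_right_cancel hab
      exact e.symm.injective (Subtype.ext (Fin.ext h1))
    have hchow := hC t.card _ hcard hinj
    refine IsLittleO.const_mul_left ?_ _
    have hfun : (fun x : ℕ => ((∑ n ∈ range x, ∏ i ∈ t, (liouville (n + i + 1) : ℤ) : ℤ) : ℝ)) =
        fun x : ℕ => ((liouvilleCorrelation
          (fun j : Fin t.card => (((e.symm j : {i // i ∈ t}) : Fin k) : ℕ) + 1) x : ℤ) : ℝ) := by
      funext x
      rw [sum_prod_liouville_eq_correlation t x e]
    rw [hfun]
    exact hchow
  have hx : (fun x : ℕ => (x : ℝ)) =o[atTop] fun x : ℕ => (x : ℝ) := by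
    have hfun : (fun x : ℕ => (x : ℝ)) = fun x : ℕ =>
        -∑ t ∈ ((Finset.univ : Finset (Fin k)).powerset).erase ∅,
          ((∏ i ∈ t, ε i : ℤ) : ℝ) *
            ((∑ n ∈ range x, ∏ i ∈ t, (liouville (n + i + 1) : ℤ) : ℤ) : ℝ) := funext hx_eq
    nth_rewrite 1 [hfun]
    exact (IsLittleO.sum hlo).neg_left
  refine Asymptotics.isLittleO_irrefl ?_ hx
  refine Filter.Eventually.frequently ?_
  rw [Filter.eventually_atTop]
  exact ⟨1, fun x hx => by positivity⟩

end Summit.ValiantsHypothesis.ValiantsHypothesis.Theorems.LiouvilleSarnakLiouvilleCutRank.SignPatterns
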